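import Summits.HodgeConjecture.CorCM.Model.RosatiTensor
import Summits.HodgeConjecture.CorCM.Model.RosatiDualForm
import Summits.HodgeConjecture.CorCM.Model.FourierOpInjective
import HarnessLib

/-!
# COR-CM model layer (row M22 `Fact_algDuality`, clause (ii) input): the Rosati tensor engine specialised to a
# CM field and to the rational cohomology of a complex abelian variety

Cell `pub-hodgecm2` (COR-CM), seat `b22`.  HONEST FRAMING: adapters only — the side hypotheses of the pure
linear-algebra engine `sum_tmul_rosati_of_balanced` (`CorCM/Model/RosatiTensor.lean`) are discharged for the
situation of row M22; nothing about algebraic cycles or the Hodge conjecture is asserted.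

The engine turns the `K`-BALANCE of the polar family `y_a = Σ_{a'} E_{a a'} b_{a'}` of an antisymmetric matrix
(`Σ_a (ι(c) b_a ⌣ y_a + b_a ⌣ ι(c) y_a) = 0` for imaginary `c`) into the ROSATI TENSOR IDENTITY
`Σ_a ι(x) b_a ⊗ y_a = Σ_a b_a ⊗ ι(x̄) y_a` (all `x ∈ K`), the input `hadj`/`hRos` of clause (ii)
(`CorCM/Model/FourierSumIntertwine.lean`, b29's `AlgDuality.lean`).  Its generic hypotheses are discharged here:

* `cupPowOne_two`, `linearIndependent_cupProduct_pairs` — for a complex abelian variety `A` and a basis `b` of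
  `H¹(A(ℂ); ℚ)`, the cup products `b_p ⌣ b_q`, `p < q`, are linearly independent in `H²(A(ℂ); ℚ)`
  (`H• = ⋀• H¹`: `linearIndependent_cupPowOne_basis` of `CorCM/Model/FourierOpInjective.lean` restricted along
  the pairs `p < q ↦` the order embedding `(p, q) : Fin 2 ↪o Fin n`);
* `sum_tmul_rosati_of_balanced_cmField` — for a CM number field `K` (Mathlib `NumberField.IsCMField`) acting on a
  `ℚ`-vector space by a ring homomorphism `ι : K → End V`: the involution is complex conjugation
  (`IsCMField.complexConj_apply_apply`), `O = 𝓞_K ⊆ K` is conjugation-stable (`ringOfIntegersComplexConj`),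
  contains a non-zero imaginary element (`IsCMField.exists_imaginary_ne_zero` +
  `exists_nsmul_mem_ringOfIntegers_imaginary`, `CorCM/Model/RosatiDualForm.lean`) and has `K` as field of
  fractions (`IsLocalization.surj`); so balance for the imaginary INTEGERS `c ∈ 𝓞_K` suffices;
* `sum_tmul_rosati_of_balanced_betti` — both together: for `A`, a basis `b` of `H¹(A(ℂ); ℚ)`, an antisymmetric
  `E` with polar family `y`, and a ring action `ι : K →+* End_ℚ H¹(A(ℂ); ℚ)` of a CM field whose imaginary
  integers are balanced for `(b, y)` under the cup product `H¹ ⊗ H¹ → H²`, the Rosati tensor identity holds for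
  every `x ∈ K` — on the corner product `P` with the diagonal action this is the `hRos` of the K-a assembly.

References: Shimura, *Abelian Varieties with Complex Multiplication* (1998) §6.2 Thm. 4; Mumford, *Abelian
Varieties* §1 (4) (`H• = ⋀• H¹`).
-/

noncomputable section

open scoped TensorProduct
open Literature.AlgebraicTopology.SingularHomology
open Literature.AlgebraicGeometry.Motives (SchemeOver ComplexPoints IsSmoothProjective bettiCohomology AbelianVariety)
open NumberField

namespace Summit.HodgeConjecture.CorCM.Model

/-! ### Pairs `p < q` and the independence of `b_p ⌣ b_q` -/

section Pairs

universe u v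

variable {R : Type v} [CommRing R] {Y : Type u} [TopologicalSpace Y]

/-- `m₂(v) = v₀ ⌣ v₁`. [folklore] -/
theorem cupPowOne_two (v : Fin 2 → singularCohomology R R Y 1) :
    cupPowOne R Y 2 v = cupProduct (rfl : 1 + 1 = 2) (v 0) (v 1) := by
  rw [cupPowOne_succ, cupPowOne_one]
  rfl

/-- The order embedding `Fin 2 ↪o Fin n` with values `p < q`. [folklore] -/
theorem strictMono_vecCons_pair {n : ℕ} {p q : Fin n} (h : p < q) : StrictMono ![p, q] := by
  refine Fin.strictMono_iff_lt_succ.2 fun i => ?_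
  fin_cases i
  simpa using h

variable (A : AbelianVariety ℂ)

/-- **The cup products `b_p ⌣ b_q` (`p < q`) of a basis `b` of `H¹(A(ℂ); ℚ)` are linearly independent in
`H²(A(ℂ); ℚ)`** (`H² = ⋀² H¹` for a complex abelian variety): the family of `linearIndependent_cupPowOne_basis`
(all `2`-element subsets) restricted along the injective map `(p < q) ↦ {p, q}`. [cite: MumfordAV1970, §1 (4)] -/
theorem linearIndependent_cupProduct_pairs {n : ℕ} (b : Module.Basis (Fin n) ℚ (bettiCohomology A.X 1)) :
    LinearIndependent ℚ fun pq : {pq : Fin n × Fin n // pq.1 < pq.2} =>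
      cupProduct (rfl : 1 + 1 = 2) (b pq.1.1) (b pq.1.2) := by
  -- the pair `p < q` as an order embedding `Fin 2 ↪o Fin n`, then as a `2`-subset
  let emb : {pq : Fin n × Fin n // pq.1 < pq.2} → (Fin 2 ↪o Fin n) :=
    fun pq => OrderEmbedding.ofStrictMono ![pq.1.1, pq.1.2] (strictMono_vecCons_pair pq.2)
  have hemb0 : ∀ pq, emb pq 0 = pq.1.1 := fun pq => rfl
  have hemb1 : ∀ pq, emb pq 1 = pq.1.2 := fun pq => rfl
  let f : {pq : Fin n × Fin n // pq.1 < pq.2} → Set.powersetCard (Fin n) 2 :=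
    fun pq => Set.powersetCard.ofFinEmbEquiv (emb pq)
  have hf : Function.Injective f := by
    intro pq pq' h
    have h' : emb pq = emb pq' := Set.powersetCard.ofFinEmbEquiv.injective h
    have h0 := congrArg (fun g : Fin 2 ↪o Fin n => g 0) h'
    have h1 := congrArg (fun g : Fin 2 ↪o Fin n => g 1) h'
    simp only [hemb0, hemb1] at h0 h1
    exact Subtype.ext (Prod.ext h0 h1)
  have hLI := (linearIndependent_cupPowOne_basis A b 2).comp f hf
  convert hLI using 1
  funext pq
  simp only [Function.comp_apply, f, Equiv.symm_apply_apply]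
  rw [cupPowOne_two]
  rfl

end Pairs

/-! ### The engine over a CM field -/

section CMField

variable {V W : Type*} [AddCommGroup V] [Module ℚ V] [AddCommGroup W] [Module ℚ W]
variable {K : Type*} [Field K] [NumberField K] [IsCMField K]

/-- **Rosati tensor identity from balance, CM-field form.**  Let `b` be a basis of a `ℚ`-vector space `V`,
`cup : V × V → W` bilinear alternating with `cup(b_p, b_q)`, `p < q`, linearly independent, `E` antisymmetric with
polar family `y_a = Σ_{a'} E_{a a'} b_{a'}`, and `ι : K → End V` a ring action of a CM number field `K`.  If the
mixed term `Σ_a (ι(c) b_a ⌣ y_a + b_a ⌣ ι(c) y_a)` vanishes for every purely imaginary algebraic INTEGER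
`c ∈ 𝓞_K` (`c̄ = -c`), then `Σ_a ι(x) b_a ⊗ y_a = Σ_a b_a ⊗ ι(x̄) y_a` for every `x ∈ K`
(`x̄ = IsCMField.complexConj K x`). [cite: Shimura1998, §6.2 Theorem 4] -/
theorem sum_tmul_rosati_of_balanced_cmField {n : ℕ} (b : Module.Basis (Fin n) ℚ V) (cup : V →ₗ[ℚ] V →ₗ[ℚ] W)
    (halt : ∀ v, cup v v = 0)
    (hLI : LinearIndependent ℚ fun pq : {pq : Fin n × Fin n // pq.1 < pq.2} => cup (b pq.1.1) (b pq.1.2))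
    (E : Fin n → Fin n → ℚ) (hE : ∀ a a', E a' a = -E a a') (y : Fin n → V)
    (hy : ∀ a, y a = ∑ a', E a a' • b a') (ι : K →+* Module.End ℚ V)
    (hbal : ∀ c : 𝓞 K, IsCMField.complexConj K (c : K) = -(c : K) →
      ∑ a, (cup (ι (c : K) (b a)) (y a) + cup (b a) (ι (c : K) (y a))) = 0)
    (x : K) :
    ∑ a, ι x (b a) ⊗ₜ[ℚ] y a = ∑ a, b a ⊗ₜ[ℚ] ι (IsCMField.complexConj K x) (y a) := by
  -- the involution, the subring `𝓞_K ⊆ K` and the engine's four side conditions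
  let σ : K →+* K := (IsCMField.complexConj K).toRingEquiv.toRingHom
  have hσ : ∀ z, σ z = IsCMField.complexConj K z := fun _ => rfl
  let O : Subring K := (algebraMap (𝓞 K) K).range
  have hO : ∀ {z : K}, z ∈ O ↔ ∃ s : 𝓞 K, (s : K) = z := fun {z} => RingHom.mem_range
  have hσσ : ∀ z, σ (σ z) = z := fun z => by rw [hσ, hσ, IsCMField.complexConj_apply_apply]
  have hσO : ∀ z ∈ O, σ z ∈ O := by
    intro z hz
    obtain ⟨s, rfl⟩ := hO.1 hz
    exact hO.2 ⟨IsCMField.ringOfIntegersComplexConj K s, IsCMField.coe_ringOfIntegersComplexConj K s⟩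
  have hex : ∃ c ∈ O, c ≠ 0 ∧ σ c = -c := by
    obtain ⟨η, hη0, hη⟩ := IsCMField.exists_imaginary_ne_zero (K := K)
    obtain ⟨m, s, hm, hs, hsσ⟩ := IsCMField.exists_nsmul_mem_ringOfIntegers_imaginary η hη
    refine ⟨(s : K), hO.2 ⟨s, rfl⟩, ?_, by rw [hσ, hsσ]⟩
    rw [← hs]
    exact smul_ne_zero (Nat.cast_ne_zero.2 hm) hη0
  have hfrac : ∀ z : K, ∃ a ∈ O, ∃ d ∈ O, d ≠ 0 ∧ z * d = a := by
    intro z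
    obtain ⟨⟨a, d⟩, h⟩ := IsLocalization.surj (nonZeroDivisors (𝓞 K)) z
    refine ⟨algebraMap (𝓞 K) K a, hO.2 ⟨a, rfl⟩, algebraMap (𝓞 K) K d, hO.2 ⟨d, rfl⟩,
      IsFractionRing.to_map_ne_zero_of_mem_nonZeroDivisors d.2, h⟩
  have hbal' : ∀ c ∈ O, σ c = -c → ∑ a, (cup (ι c (b a)) (y a) + cup (b a) (ι c (y a))) = 0 := by
    intro c hc hcσ
    obtain ⟨s, rfl⟩ := hO.1 hc
    exact hbal s (by rw [← hσ]; exact hcσ)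
  have h := sum_tmul_rosati_of_balanced b cup halt hLI E hE y hy ι σ hσσ O hσO hex hfrac hbal' x
  rw [hσ] at h
  exact h

end CMField

/-! ### The engine on `H¹(A(ℂ); ℚ)` -/

section Betti

variable (A : AbelianVariety ℂ) {K : Type*} [Field K] [NumberField K] [IsCMField K]

/-- **Rosati tensor identity on `H¹(A(ℂ); ℚ)` from balance of the imaginary integers.**  For a complex abelian
variety `A`, a basis `b` of `H¹(A(ℂ); ℚ)`, an antisymmetric matrix `E` with polar family
`y_a = Σ_{a'} E_{a a'} b_{a'}`, and a ring action `ι : K → End_ℚ H¹(A(ℂ); ℚ)` of a CM number field such that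
`Σ_a (ι(c) b_a ⌣ y_a + b_a ⌣ ι(c) y_a) = 0` in `H²(A(ℂ); ℚ)` for every purely imaginary `c ∈ 𝓞_K`
(`K`-balance of the polarisation `θ = ½ Σ_a b_a ⌣ y_a`), one has
`Σ_a ι(x) b_a ⊗ y_a = Σ_a b_a ⊗ ι(x̄) y_a` in `H¹ ⊗_ℚ H¹` for every `x ∈ K`.  (On the corner product `P` with the
diagonal `K`-action this is the hypothesis `hadj`/`hRos` of clause (ii), `CorCM/Model/FourierSumIntertwine.lean`.)
[cite: Shimura1998, §6.2 Theorem 4] -/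
theorem sum_tmul_rosati_of_balanced_betti {n : ℕ} (b : Module.Basis (Fin n) ℚ (bettiCohomology A.X 1))
    (E : Fin n → Fin n → ℚ) (hE : ∀ a a', E a' a = -E a a') (y : Fin n → bettiCohomology A.X 1)
    (hy : ∀ a, y a = ∑ a', E a a' • b a') (ι : K →+* Module.End ℚ (bettiCohomology A.X 1))
    (hbal : ∀ c : 𝓞 K, IsCMField.complexConj K (c : K) = -(c : K) →
      ∑ a, (cupProduct (rfl : 1 + 1 = 2) (ι (c : K) (b a)) (y a) +
        cupProduct (rfl : 1 + 1 = 2) (b a) (ι (c : K) (y a))) = 0)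
    (x : K) :
    ∑ a, ι x (b a) ⊗ₜ[ℚ] y a = ∑ a, b a ⊗ₜ[ℚ] ι (IsCMField.complexConj K x) (y a) :=
  sum_tmul_rosati_of_balanced_cmField b (cupProduct (rfl : 1 + 1 = 2)) cup_self_deg_one
    (linearIndependent_cupProduct_pairs A b) E hE y hy ι hbal x

end Betti

end Summit.HodgeConjecture.CorCM.Model

end
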